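import Summits.SmoothPoincare4.SmoothPoincare4.Theorems.SymplecticOrigamiGromovRecognitionRelEndStubFlatLeavesAux
import Summits.SmoothPoincare4.SmoothPoincare4.Theorems.SymplecticOrigamiGromovRecognitionRelEndStubFlatLeavesAux2
import Mathlib

/-!
# Flat leaves for `GromovRecognitionRelEnd` — the flat lines `{z₁ = c}` are `V`-leaves
(stub `stub_flatLeaves` of line `cross-cap-laurent`, crux `SymplecticOrigami.GromovRecognitionRelEnd`,
item stmt-SmoothPoincare4-11009; fourth auxiliary file: the `V` case)

In the wedge cap `X = ι(M) ⊔ (H∞ ∪ V∞)` with its three product charts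
`ηV (u, z₂) = ι χ (1/u, z₂)`, `ηH (z₁, t) = ι χ (z₁, 1/t)`, `ηC (u, t) = ι χ (1/u, 1/t)` (only the
clauses of the cap block that are used appear as hypotheses, verbatim), let `lamV : X → X` be the
`C^∞` retraction onto `H∞` produced by the core stub (values in `H∞`, identity on the affine axis
`ηH {p₂ = p₃ = 0}`, corner criterion `lamV y = ηC 0 ↔ y ∈ V∞`, `JX`-invariant kernel, positive
holonomy — only the first three are used here).  This file builds (`flatLeaf_V_sphere`), for
`|z₁(w)| > R₁`, the flat line `{z₁ = (w₀, w₁)}` through `ι χ w` as a `C^∞` `JX`-sphere adapted to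
`lamV`, i.e. exactly the data consumed by the leaf-constancy theorem `FlatLeaves.leaf_const` of
file `Aux3` (applied in the stub file): with `c = (w₀, w₁)` and `a = 1/c` (`|a| < R₁⁻¹`), the
affine charts are `u z = ηV (a, z)` (a `JX`-holomorphic slice of the holomorphic chart `ηV`, file
`Aux2`) and `v z = u (1/z)` extended by `v 0 = ηC (a, 0) = ηH (c, 0)` (the gluing clauses
`ηC = ηV ∘ inv₂ = ηH ∘ inv₁`); `u` runs in `range ι`, hence misses `V∞`, so `u` and `v` run in
the open set `S = {lamV ≠ ηC 0}` on which `lamV` takes values in the affine axis of `H∞`; the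
complex coordinates `z₁`, `z₂` of `ℝ⁴` are produced as real-linear maps (`z₁ ∘ (i ⊕ i) = i z₁`,
jointly injective); and `u (w₂ + i w₃) = ι χ w`, `lamV (v 0) = ηH (c, 0)`.

Everything is proved; no definition, no named fact.

References: M. Gromov, *Pseudo holomorphic curves in symplectic manifolds*, Invent. Math. 82
(1985), 2.4.A₁′–A₂′ [Gromov1985].
-/

noncomputable section

-- the registered namespace `Summit.SmoothPoincare4.SmoothPoincare4.Theorems…` repeats a component
set_option linter.dupNamespace false

open scoped Manifold ContDiff Topology
open Set Function Filter Literature.Geometry.Symplectic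

namespace Summit.SmoothPoincare4.SmoothPoincare4.Theorems.GromovRecognitionRelEnd.CrossCapLaurent

namespace FlatLeaves

open CapModel

/-! ## Coordinates of the `V`-slices `t ↦ (a₀, a₁, t)` -/

section SliceV

variable (a₀ a₁ : ℝ)

/-- `|z₁|²` is constant along a `V`-slice. [folklore] -/
theorem r1_sliceV (t : ℂ) : r1 (WithLp.toLp 2 ![a₀, a₁, t.re, t.im] : EuclideanSpace ℝ (Fin 4)) = a₀ ^ 2 + a₁ ^ 2 := by
  simp [r1_def]

/-- `|z₂|² = |t|²` along a `V`-slice. [folklore] -/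
theorem r2_sliceV (t : ℂ) :
    r2 (WithLp.toLp 2 ![a₀, a₁, t.re, t.im] : EuclideanSpace ℝ (Fin 4)) = Complex.normSq t := by
  simp [r2_def, Complex.normSq_apply, sq]

/-- **The second inversion acts on a `V`-slice as `t ↦ 1/t`** (`1/t = t̄/|t|²`; also for `t = 0`
with the junk values `x/0 = 0`, `0⁻¹ = 0`). [folklore] -/
theorem inv2_sliceV (t : ℂ) : inv2 (WithLp.toLp 2 ![a₀, a₁, t.re, t.im] : EuclideanSpace ℝ (Fin 4)) =
    WithLp.toLp 2 ![a₀, a₁, t⁻¹.re, t⁻¹.im] := by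
  ext i
  fin_cases i
  · simp
  · simp
  · simp [r2_def, Complex.inv_re, Complex.normSq_apply, sq, div_eq_mul_inv]
  · simp [r2_def, Complex.inv_im, Complex.normSq_apply, sq, div_eq_mul_inv, neg_mul]

/-- **The first inversion straightens a `V`-slice**: for `a = 1/c` (`c = (w₀, w₁) ≠ 0`),
`inv₁ (a, t) = (c, t)`. [folklore] -/
theorem inv1_sliceV_inv1 (w : EuclideanSpace ℝ (Fin 4)) (hw : r1 w ≠ 0) (t : ℂ) :
    inv1 (WithLp.toLp 2 ![inv1 w 0, inv1 w 1, t.re, t.im] : EuclideanSpace ℝ (Fin 4)) =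
      WithLp.toLp 2 ![w 0, w 1, t.re, t.im] := by
  have hr : r1 (WithLp.toLp 2 ![inv1 w 0, inv1 w 1, t.re, t.im] : EuclideanSpace ℝ (Fin 4)) = (r1 w)⁻¹ := by
    rw [r1_sliceV, ← r1_inv1 w, r1_def (inv1 w)]
  have hr0 : (r1 w)⁻¹ ≠ 0 := inv_ne_zero hw
  ext i
  fin_cases i
  · show inv1 _ 0 = _
    rw [inv1_apply0, hr]
    simp
    field_simp
  · show inv1 _ 1 = _
    rw [inv1_apply1, hr]
    simp
    field_simp
  · show inv1 _ 2 = _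
    simp
  · show inv1 _ 3 = _
    simp

end SliceV

/-! ## The `V` case -/

/-- **The flat line `{z₁ = c}`, `|c| > R₁`, as a `JX`-sphere adapted to `lamV`** (the data of
Gromov 1985, 2.4.A₂′ "suppose the form has been already split near `S₁ ∪ S₂`": here `J = i ⊕ i`
beyond `R₁`).  See the file header. [cite: Gromov1985, 2.4.A₂′] -/
theorem flatLeaf_V_sphere {M X : Type*} [TopologicalSpace X] [T2Space X]
    [ChartedSpace (EuclideanSpace ℝ (Fin 4)) X]
    (JX : ∀ y : X, TangentSpace (𝓡 4) y →L[ℝ] TangentSpace (𝓡 4) y)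
    (ι : M → X) (χ : EuclideanSpace ℝ (Fin 4) → M) (ηH ηV ηC : EuclideanSpace ℝ (Fin 4) → X) {R₁ : ℝ} (hR₁ : 0 < R₁)
    (hVloc : IsLocalDiffeomorphOn 𝓘(ℝ, EuclideanSpace ℝ (Fin 4)) (𝓡 4) ∞ ηV {p : EuclideanSpace ℝ (Fin 4) | p 0 ^ 2 + p 1 ^ 2 < R₁⁻¹ ^ 2})
    (hVglue : ∀ p : EuclideanSpace ℝ (Fin 4), p 0 ^ 2 + p 1 ^ 2 < R₁⁻¹ ^ 2 → (p 0 ≠ 0 ∨ p 1 ≠ 0) →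
      ηV p = ι (χ (WithLp.toLp 2
        ![p 0 / (p 0 ^ 2 + p 1 ^ 2), -(p 1) / (p 0 ^ 2 + p 1 ^ 2), p 2, p 3])))
    (hVax : ∀ p : EuclideanSpace ℝ (Fin 4), p 0 = 0 → p 1 = 0 → ηV p ∉ Set.range ι)
    (hVhol : ∀ p : EuclideanSpace ℝ (Fin 4), p 0 ^ 2 + p 1 ^ 2 < R₁⁻¹ ^ 2 → ∀ q : EuclideanSpace ℝ (Fin 4),
      JX (ηV p) (mfderiv 𝓘(ℝ, EuclideanSpace ℝ (Fin 4)) (𝓡 4) ηV p q) =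
        mfderiv 𝓘(ℝ, EuclideanSpace ℝ (Fin 4)) (𝓡 4) ηV p (WithLp.toLp 2 ![-(q 1), q 0, -(q 3), q 2]))
    (hCloc : IsLocalDiffeomorphOn 𝓘(ℝ, EuclideanSpace ℝ (Fin 4)) (𝓡 4) ∞ ηC
      {p : EuclideanSpace ℝ (Fin 4) | p 0 ^ 2 + p 1 ^ 2 < R₁⁻¹ ^ 2 ∧ p 2 ^ 2 + p 3 ^ 2 < R₁⁻¹ ^ 2})
    (hCinj : Set.InjOn ηC {p : EuclideanSpace ℝ (Fin 4) | p 0 ^ 2 + p 1 ^ 2 < R₁⁻¹ ^ 2 ∧ p 2 ^ 2 + p 3 ^ 2 < R₁⁻¹ ^ 2})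
    (hCV : ∀ p : EuclideanSpace ℝ (Fin 4), p 0 ^ 2 + p 1 ^ 2 < R₁⁻¹ ^ 2 → p 2 ^ 2 + p 3 ^ 2 < R₁⁻¹ ^ 2 →
      (p 2 ≠ 0 ∨ p 3 ≠ 0) →
      ηC p = ηV (WithLp.toLp 2 ![p 0, p 1, p 2 / (p 2 ^ 2 + p 3 ^ 2), -(p 3) / (p 2 ^ 2 + p 3 ^ 2)]))
    (hCH : ∀ p : EuclideanSpace ℝ (Fin 4), p 0 ^ 2 + p 1 ^ 2 < R₁⁻¹ ^ 2 → p 2 ^ 2 + p 3 ^ 2 < R₁⁻¹ ^ 2 →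
      (p 0 ≠ 0 ∨ p 1 ≠ 0) →
      ηC p = ηH (WithLp.toLp 2 ![p 0 / (p 0 ^ 2 + p 1 ^ 2), -(p 1) / (p 0 ^ 2 + p 1 ^ 2), p 2, p 3]))
    (hC0 : ηC 0 ∉ Set.range ι)
    (lamV : X → X) (hlam : ContMDiff (𝓡 4) (𝓡 4) ∞ lamV)
    (hinto : ∀ y : X, (∃ p : EuclideanSpace ℝ (Fin 4), p 2 = 0 ∧ p 3 = 0 ∧ ηH p = lamV y) ∨
      lamV y = ηC 0)
    (hret : ∀ p : EuclideanSpace ℝ (Fin 4), p 2 = 0 → p 3 = 0 → lamV (ηH p) = ηH p)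
    (hcorn : ∀ y : X, lamV y = ηC 0 ↔
      ((∃ q : EuclideanSpace ℝ (Fin 4), q 0 = 0 ∧ q 1 = 0 ∧ ηV q = y) ∨ y = ηC 0))
    (w : EuclideanSpace ℝ (Fin 4)) (hw : R₁ ^ 2 < w 0 ^ 2 + w 1 ^ 2) :
    ∃ (π₁ π₂ : EuclideanSpace ℝ (Fin 4) →L[ℝ] ℂ) (S : Set X) (u v : ℂ → X),
      (∀ q, π₁ (I4 q) = Complex.I * π₁ q) ∧ (∀ q, π₁ q = 0 → π₂ q = 0 → q = 0) ∧ IsOpen S ∧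
      (∀ y ∈ S, ∃ p ∈ {p : EuclideanSpace ℝ (Fin 4) | p 2 ^ 2 + p 3 ^ 2 < R₁⁻¹ ^ 2},
        π₂ p = 0 ∧ ηH p = lamV y) ∧
      ContMDiff 𝓘(ℝ, ℂ) (𝓡 4) ∞ u ∧ ContMDiff 𝓘(ℝ, ℂ) (𝓡 4) ∞ v ∧ (∀ z : ℂ, z ≠ 0 → v z = u z⁻¹) ∧
      IsJHolomorphic (𝓡 4) JX u ∧ (∀ z, u z ∈ S) ∧ (∀ z, v z ∈ S) ∧
      u ⟨w 2, w 3⟩ = ι (χ w) ∧ lamV (v 0) = ηH (WithLp.toLp 2 ![w 0, w 1, 0, 0]) := by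
  -- linear algebra of `ℝ⁴ = ℂ²`
  obtain ⟨π₁, hπ₁, hπ₁I⟩ := exists_clm_coord01
  obtain ⟨π₂, hπ₂, -⟩ := exists_clm_coord23
  obtain ⟨T, hT, hTI⟩ := exists_clm_slice23
  have hπ : ∀ q : EuclideanSpace ℝ (Fin 4), π₁ q = 0 → π₂ q = 0 → q = 0 := fun q => eq_zero_of_coords hπ₁ hπ₂
  -- the three coordinate domains
  set DV : Set (EuclideanSpace ℝ (Fin 4)) := {p : EuclideanSpace ℝ (Fin 4) | p 0 ^ 2 + p 1 ^ 2 < R₁⁻¹ ^ 2} with hDV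
  set DH : Set (EuclideanSpace ℝ (Fin 4)) := {p : EuclideanSpace ℝ (Fin 4) | p 2 ^ 2 + p 3 ^ 2 < R₁⁻¹ ^ 2} with hDH
  set DC : Set (EuclideanSpace ℝ (Fin 4)) := {p : EuclideanSpace ℝ (Fin 4) | p 0 ^ 2 + p 1 ^ 2 < R₁⁻¹ ^ 2 ∧ p 2 ^ 2 + p 3 ^ 2 < R₁⁻¹ ^ 2}
    with hDC
  have hR : (0 : ℝ) < R₁⁻¹ ^ 2 := by positivity
  -- the point: `c = (w₀, w₁)`, `a = 1/c`
  have hr1w : R₁ ^ 2 < r1 w := hw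
  have hr1w0 : r1 w ≠ 0 := r1_ne_zero_of_sq_lt hr1w
  have hr1a : (inv1 w 0) ^ 2 + (inv1 w 1) ^ 2 < R₁⁻¹ ^ 2 := by
    have h := r1_inv1_lt hR₁ hr1w
    rwa [r1_def] at h
  have ha0 : inv1 w 0 ≠ 0 ∨ inv1 w 1 ≠ 0 := by
    have h : r1 (inv1 w) ≠ 0 := by rw [r1_inv1]; exact inv_ne_zero hr1w0
    exact (r1_ne_zero_iff _).1 h
  -- the slice `s t = (a, t)` and its coordinates
  set s : ℂ → EuclideanSpace ℝ (Fin 4) := fun t => WithLp.toLp 2 ![inv1 w 0, inv1 w 1, t.re, t.im] with hs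
  have hs_fd : ∀ t, HasFDerivAt s T t := hasFDerivAt_slice23 hT (inv1 w 0) (inv1 w 1)
  have hs0 : ∀ t, s t 0 = inv1 w 0 := fun t => by simp [hs]
  have hs1 : ∀ t, s t 1 = inv1 w 1 := fun t => by simp [hs]
  have hs2 : ∀ t, s t 2 = t.re := fun t => by simp [hs]
  have hs3 : ∀ t, s t 3 = t.im := fun t => by simp [hs]
  have hsDV : ∀ t, s t ∈ DV := fun t => by
    show s t 0 ^ 2 + s t 1 ^ 2 < R₁⁻¹ ^ 2
    rw [hs0, hs1]; exact hr1a
  have hsoff : ∀ t, s t 0 ≠ 0 ∨ s t 1 ≠ 0 := fun t => by rw [hs0, hs1]; exact ha0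
  have hsDC : ∀ t : ℂ, Complex.normSq t < R₁⁻¹ ^ 2 → s t ∈ DC := fun t ht =>
    ⟨hsDV t, by show r2 (s t) < R₁⁻¹ ^ 2; rw [hs, r2_sliceV]; exact ht⟩
  have hinv1s : ∀ t, inv1 (s t) = WithLp.toLp 2 ![w 0, w 1, t.re, t.im] := fun t =>
    inv1_sliceV_inv1 w hr1w0 t
  have hinv2s : ∀ t, inv2 (s t) = s t⁻¹ := fun t => inv2_sliceV _ _ t
  -- the first affine chart `u = ηV ∘ s` of the flat line
  set u : ℂ → X := fun t => ηV (s t) with hu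
  have hVD : ∀ p ∈ DV, ContMDiffAt 𝓘(ℝ, EuclideanSpace ℝ (Fin 4)) (𝓡 4) ∞ ηV p := fun p hp =>
    contMDiffAt_of_mem hVloc hp
  have hu_smooth : ContMDiff 𝓘(ℝ, ℂ) (𝓡 4) ∞ u := contMDiff_comp_slice hVD hs_fd hsDV
  have hu_hol : IsJHolomorphic (𝓡 4) JX u :=
    isJHolomorphic_comp_slice (fun p hp => (hVD p hp).mdifferentiableAt (by simp))
      (fun p hp q => hVhol p hp q) hs_fd hTI hsDV
  have hu_glue : ∀ t, u t = ι (χ (inv1 (s t))) := fun t => hVglue (s t) (hsDV t) (hsoff t)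
  have hu_range : ∀ t, u t ∈ Set.range ι := fun t => ⟨χ (inv1 (s t)), (hu_glue t).symm⟩
  have hu_base : u ⟨w 2, w 3⟩ = ι (χ w) := by
    rw [hu_glue, hinv1s]
    congr 2
    ext i
    fin_cases i <;> simp
  -- the second affine chart `v = u (1/t)`, `v 0 = ηC (a, 0) = ηH (c, 0)`
  set v : ℂ → X := fun t => if t = 0 then ηC (s 0) else u t⁻¹ with hv
  have hCt : ∀ t : ℂ, Complex.normSq t < R₁⁻¹ ^ 2 → t ≠ 0 → ηC (s t) = u t⁻¹ := by
    intro t ht ht0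
    have h23 : s t 2 ≠ 0 ∨ s t 3 ≠ 0 := by
      rw [hs2, hs3]
      by_contra hc
      simp only [not_or, not_not] at hc
      exact ht0 (Complex.ext hc.1 hc.2)
    rw [hCV (s t) (hsDC t ht).1 (hsDC t ht).2 h23]
    show ηV (inv2 (s t)) = ηV (s t⁻¹)
    rw [hinv2s]
  have hC0s : ContMDiffAt 𝓘(ℝ, ℂ) (𝓡 4) ∞ (fun t => ηC (s t)) 0 :=
    (contMDiffAt_of_mem hCloc (hsDC 0 (by simpa using hR))).comp 0
      (contDiff_of_hasFDerivAt_const hs_fd).contMDiff.contMDiffAt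
  have hv_smooth : ContMDiff 𝓘(ℝ, ℂ) (𝓡 4) ∞ v :=
    contMDiff_inversionGlue hu_smooth hC0s
      ((eventually_normSq_lt hR).mono fun t ht ht0 => hCt t ht ht0)
  have huv : ∀ t : ℂ, t ≠ 0 → v t = u t⁻¹ := fun t ht => if_neg ht
  have hv0 : v 0 = ηH (WithLp.toLp 2 ![w 0, w 1, 0, 0]) := by
    have h0 : v 0 = ηC (s 0) := if_pos rfl
    rw [h0, hCH (s 0) (hsDC 0 (by simpa using hR)).1 (hsDC 0 (by simpa using hR)).2 (hsoff 0)]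
    show ηH (inv1 (s 0)) = _
    rw [hinv1s]
    simp
  -- the open set `S = {lamV ≠ corner}` where `lamV` reads in the affine chart of `H∞`
  set S : Set X := {y : X | lamV y ≠ ηC 0} with hSdef
  have hS : IsOpen S := isOpen_ne_fun hlam.continuous continuous_const
  have hSax : ∀ y ∈ S, ∃ p ∈ DH, π₂ p = 0 ∧ ηH p = lamV y := by
    intro y hy
    rcases hinto y with ⟨p, hp2, hp3, hpy⟩ | h
    · refine ⟨p, ?_, ?_, hpy⟩
      · show p 2 ^ 2 + p 3 ^ 2 < R₁⁻¹ ^ 2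
        rw [hp2, hp3]; simpa using hR
      · rw [hπ₂, hp2, hp3]; rfl
    · exact absurd h hy
  have hrangeS : ∀ y ∈ Set.range ι, y ∈ S := by
    rintro _ ⟨x, rfl⟩ h
    rcases (hcorn (ι x)).1 h with ⟨q, hq0, hq1, hqy⟩ | h'
    · exact hVax q hq0 hq1 ⟨x, hqy.symm⟩
    · exact hC0 ⟨x, h'⟩
  have huS : ∀ t, u t ∈ S := fun t => hrangeS _ (hu_range t)
  have hcornerH : ηH (WithLp.toLp 2 ![w 0, w 1, 0, 0]) ≠ ηC 0 := by
    intro h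
    have h1 : ηC (s 0) = ηC 0 := by rw [← h, ← hv0]; exact (if_pos rfl).symm
    have h0DC : (0 : EuclideanSpace ℝ (Fin 4)) ∈ DC := ⟨by simpa using hR, by simpa using hR⟩
    have hs00 := hCinj (hsDC 0 (by simpa using hR)) h0DC h1
    rcases hsoff 0 with h0 | h0
    · exact h0 (by rw [hs00]; rfl)
    · exact h0 (by rw [hs00]; rfl)
  have hvS : ∀ t, v t ∈ S := by
    intro t
    by_cases ht : t = 0
    · subst ht
      show lamV (v 0) ≠ ηC 0
      rw [hv0, hret _ (by simp) (by simp)]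
      exact hcornerH
    · rw [huv t ht]; exact huS _
  exact ⟨π₁, π₂, S, u, v, hπ₁I, hπ, hS, hSax, hu_smooth, hv_smooth, huv, hu_hol, huS, hvS, hu_base,
    by rw [hv0, hret _ (by simp) (by simp)]⟩

end FlatLeaves

/-- **Registered helper sub-goal `helper_flatLeavesSliceInversion`** (fourth auxiliary file of stub
`stub_flatLeaves`): on a `V`-slice `t ↦ (a₀, a₁, t)` of `ℝ⁴ = ℂ²` the inversion of the second
factor (the transition map of the cap charts, written with the junk value `x/0 = 0` as in the
registered signature) is `t ↦ 1/t`. [folklore] -/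
theorem helper_flatLeavesSliceInversion : ∀ (a₀ a₁ : ℝ) (t : ℂ),
    (WithLp.toLp 2 ![a₀, a₁, t.re / (t.re ^ 2 + t.im ^ 2), -t.im / (t.re ^ 2 + t.im ^ 2)] :
      EuclideanSpace ℝ (Fin 4)) = WithLp.toLp 2 ![a₀, a₁, t⁻¹.re, t⁻¹.im] := by
  intro a₀ a₁ t
  have h := FlatLeaves.inv2_sliceV a₀ a₁ t
  rw [CapModel.inv2] at h
  simpa using h

end Summit.SmoothPoincare4.SmoothPoincare4.Theorems.GromovRecognitionRelEnd.CrossCapLaurent
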